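import Literature.Probability.FitznerVanDerHofstad2017.MeanFieldD11AppDFull
import Literature.Probability.FitznerVanDerHofstad2017.NobleWeightedConvolution
import HarnessLib

/-!
# Mean-field behaviour at `d = 11` on the kernel App.-D line, VI: the certificate at the β-table with the Step-4 bookkeeping constant `β^corr_{ΔR,F}` (DIVERGENCE D65)

CITATION HEADER (PLACEMENT v2). Part of the certified REPRODUCTION of R. Fitzner, R. van der Hofstad, *Mean-field behavior for
nearest-neighbor percolation in d > 10*, EJP 22 (2017) no. 43 [FvdH17] and *Generalized approach to the non-backtracking lace
expansion*, PTRF 169 (2017) 1041–1119 [NoBLE17]; build `lace`, seat lean2 (gen 13), module 12.  ADDITIVE: `MeanFieldD11Cert` (rev 6,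
the certificate OF RECORD), `MeanFieldD11Inputs`, `NobleInstantiate`, `NobleAssumptions`, the generated `BetaMap` and modules I–V of
this line are untouched; the record `γ = gammaC` is untouched; nothing here is a cited fact; no `def … : Prop`.

CONTEXT.  `NobleWeightedConvolution` (module 3c-A of the App.-D kernel reconstruction, Part C) defines the constant
`BetaMap.betaRfDeltaCorr` that the Step-4 bookkeeping of [NoBLE17] App. D yields for (D.32) and the table
`BetaMap.nobleBetaOfInputsCorr d i := { nobleBetaOfInputs d i with βΔ := betaRfDeltaCorr … }` (programme note HOME/DIVERGENCE.md
D65: line 7 of the transcribed display (D.32) carries fewer cross-term parity products than the bookkeeping produces; the kernel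
derivation of Steps 3–5, module 3c-B, is written against the bookkeeping constant).  D65 records float estimates at `d = 11` and
names as lean2's action the re-evaluation of the App.-D-line certificate at that table with a re-chosen `γ₂`
(`f₂`-condition of [NoBLE17] Def. 2.9: `f2Bound(β) = (2d−1)/(2d−2)·(c̄_Φ + β_{α,Φ} + β_{R,Φ})/(α̲_F − β_Δ) ≤ γ₂ < Γ₂`; `β_Δ` enters
only `f2Bound` and `Admissible`).  THIS MODULE IS THAT RE-EVALUATION, in the kernel (exact rational arithmetic, `norm_num`):

KERNEL FACTS at `d = 11` (published records `D11.inputsI`, `D11.inputsO`; App.-D line = the β-map AS WIRED, DIVERGENCE D29):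
* `β^corr_Δ(o) − β_Δ(o) ∈ [1.48·10⁻⁴, 1.49·10⁻⁴]`, `β^corr_Δ(i) − β_Δ(i) ∈ [6.3·10⁻⁵, 6.4·10⁻⁵]` (`betaDeltaCorr_sub_o/_i`);
* `f2Bound(β(inputsO)) ∈ (1.10824, 1.108241]` (the line of module I) and `f2Bound(β^corr(inputsO)) ∈ (1.10841, 1.108412]`
  (`f2Bound_o_brackets`, `f2BoundCorr_o_brackets`); hence **`f2Bound(β^corr(inputsO)) ≤ γ₂` FAILS for the record's
  `γ₂ = gammaC 1 = 1.108259`** (`f2BoundCorr_o_not_le_gammaC`) **and HOLDS below `Γ₂ = GammaC 1 = 1.1084502`**;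
  `f2Bound(β^corr(inputsI)) ≤ 1.064` (`f2BoundCorr_i_le`);
* with the re-chosen `γ' = gammaD65 := (γ₁, 1.10845, γ₃)` (ONLY `γ₂` moved, into `[f2Bound(β^corr(inputsO)), Γ₂)`; `γ₁`, `γ₃`, `Γ`,
  `c_μ`, `c`, `bi`, `bo` of record — `bo` being rev 6's β_Δ-WIRED f₃ table, see the f₃-TABLE CLAUSE below) **every inequality of the
  input-level certificate `P(γ', Γ)` holds, AS TYPED, at `(β^corr(inputsI), β^corr(inputsO))`** — `nobleCertificate_d11_corr` (the two `f₂`-fields and the two admissibilities re-evaluated,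
  the seven other fields those of `nobleCertificate_d11_inputs` up to `γ'₁ = γ₁`, `γ'₃ = γ₃`);
* hence `meanField_d11_corr` / `meanField_full_d11_corr : NobleInitialInputsAt 11 β^corr(inputsI) bi → NobleImprovementInputsAt 11
  c_μ c Γ β^corr(inputsO) bo → MeanField 11` ([NoBLE17] Thm 2.10 / Prop. 2.11 via `meanField_of_certificate`, exponents via
  `meanField_of_triangle`) — the two oracle binders being exactly what module 3c-B's announced `nobleSimplifiedFormAt_percolation₅`
  (Prop. 4.5(ii) with the `βΔ` slot `β^corr_Δ`, (D.32) DISCHARGED from Assumption 4.3) will supply per `p` together with (S2b).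
f₃-TABLE CLAUSE (REFEREE v56 R319 (e) = ORDERS v56 W56.2; REFEREE2 v48 ref2-R44 (b)): `bo` here is rev 6's β_Δ-WIRED f₃
table (`Percolation.nb` cell [144] passes `1/(α_F,low − β_Δ)` as the last argument of every `s = o` `BoundFThreeBound` cell, so the six
`bo` literals are functions of `β_Δ`, while `bi` is not); the corrected chain's `b_o` at this cell (O12g U(12,28)) exceeds `c001` on
engine B (finding C46-F3, ONE engine: `b_o,{0,0,1}/c001 = 1.000103` as coded, `1.000080` printed wiring, `> Γ₃ = 1`), so this is the
KERNEL SHAPE of the D65 certificate, not its corrected numerics — closing requires Cert rev 7 (O12g U(13,28), fallback O12h-B; two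
engines; C46 BLOCKING).  In particular NO sentence of this module says that `P(γ', Γ)` holds at `β^corr` with CORRECTED f₃ tables:
the kernel theorems below pair `β^corr(inputsO)` with the rev-6 `bo` literal, exactly as typed (valid as typed, R319 (e)).
REVISION 2 (lean2 gen 14, W56.2): module docstring and two declaration docstrings only; every declaration is byte-identical to
revision 1 (p187473).

EPISTEMIC STATUS / BOUNDARY.  `gammaD65` is a kernel-feasible choice of the FREE proof parameter `γ₂` of [NoBLE17] Def. 2.9 on the
App.-D line; it is NOT a revision of the certificate of record (`MeanFieldD11Cert` rev 6, `γ = gammaC`, tables `Bi`/`Bo` of the two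
engines), whose `γ₂` re-choice — if any — is the referee's Cert decision after the two-engine confirmation asked for in D65.  ONE
engine here (Lean's exact arithmetic on the typed map); the float estimates of D65 for the App.-D line (`f₂(o)` 1.1082402 → 1.1084115,
`Δβ_Δ(o)` = 1.485·10⁻⁴) are CONFIRMED by the kernel brackets; its `Δβ_Δ(i)` = 6.54·10⁻⁵ reads 6.3–6.4·10⁻⁵ here (harmless: the `i`-side
margin is 4·10⁻²).  The displayed constant of `NobleBootstrapBound 11` on this line weakens from `(20/21)·γ₂` to `(20/21)·γ'₂`
(+1.8·10⁻⁴).  No sentence about any `d ≠ 11`.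

[cite: FitznerVanDerHofstad2016NoBLE, Def. 2.9 (P(γ, Γ): conditions on γ₁, γ₂, γ₃), Prop. 2.11, Thm 2.10 (pp. 1060–1062); App. D Step 4 (D.24)–(D.29), Step 5 (D.30)–(D.32) (pp. 1115–1117)]
[cite: FitznerVanDerHofstad2017, Thm 1.1 / Cor. 1.3 (d = 11), §2.5–§2.7 (γ, Γ, c_μ of the d = 11 run)]
-/

namespace Literature.Probability.FitznerVanDerHofstad2017

open _root_.MeasureTheory _root_.Filter _root_.Topology Literature.Probability.LatticeModels
open Literature.Barriers.CriticalPhenomena Literature.Probability.Percolation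
open scoped BigOperators

namespace D11

/-! ## 1. The re-chosen `γ'` (only `γ₂` moves) -/

/-- `γ' := (γ₁, 1.10845, γ₃)`: the record's `gammaC` with `γ₂` re-chosen inside `[f2Bound(β^corr(inputsO)), Γ₂)`; a FREE proof
parameter of [NoBLE17] Def. 2.9, not a table of [FvdH17] and not the certificate of record. [cite: FitznerVanDerHofstad2016NoBLE, Def. 2.9 (p. 1060)] -/
def gammaD65 : Fin 3 → ℝ := ![1.0119705, 1.10845, 0.99989]

/-- [folklore] -/
@[simp] theorem gammaD65_zero : gammaD65 0 = gammaC 0 := by simp [gammaD65, gammaC]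
/-- [folklore] -/
@[simp] theorem gammaD65_two : gammaD65 2 = gammaC 2 := by simp [gammaD65, gammaC]
/-- [folklore] -/
theorem gammaD65_one : gammaD65 1 = 1.10845 := by simp [gammaD65]

/-! ## 2. Kernel brackets at `d = 11` (DIVERGENCE D65, App.-D line) -/

set_option maxHeartbeats 4000000 in
/-- `β^corr_Δ(inputsO) − β_Δ(inputsO) ∈ [1.48·10⁻⁴, 1.49·10⁻⁴]` (D65 float: 1.485·10⁻⁴). [cite: FitznerVanDerHofstad2016NoBLE, App. D (D.32) p. 1117] -/
theorem betaDeltaCorr_sub_o :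
    0.000148 ≤ (BetaMap.nobleBetaOfInputsCorr 11 inputsO).βΔ - (BetaMap.nobleBetaOfInputs 11 inputsO).βΔ ∧
      (BetaMap.nobleBetaOfInputsCorr 11 inputsO).βΔ - (BetaMap.nobleBetaOfInputs 11 inputsO).βΔ ≤ 0.000149 := by
  constructor <;> norm_num [inputsO, BetaMap.nobleBetaOfInputsCorr, BetaMap.betaRfDeltaCorr, BetaMap.nobleBetaOfInputs, BetaMap.betaRfDeltaLower]

set_option maxHeartbeats 4000000 in
/-- `β^corr_Δ(inputsI) − β_Δ(inputsI) ∈ [6.3·10⁻⁵, 6.4·10⁻⁵]`. [cite: FitznerVanDerHofstad2016NoBLE, App. D (D.32) p. 1117] -/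
theorem betaDeltaCorr_sub_i :
    0.000063 ≤ (BetaMap.nobleBetaOfInputsCorr 11 inputsI).βΔ - (BetaMap.nobleBetaOfInputs 11 inputsI).βΔ ∧
      (BetaMap.nobleBetaOfInputsCorr 11 inputsI).βΔ - (BetaMap.nobleBetaOfInputs 11 inputsI).βΔ ≤ 0.000064 := by
  constructor <;> norm_num [inputsI, BetaMap.nobleBetaOfInputsCorr, BetaMap.betaRfDeltaCorr, BetaMap.nobleBetaOfInputs, BetaMap.betaRfDeltaLower]

set_option maxHeartbeats 4000000 in
/-- `f2Bound(β(inputsO)) ∈ (1.10824, 1.108241]` on the App.-D line of module I (record `γ₂ = 1.108259` holds there with margin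
`≈ 1.8·10⁻⁵`). [cite: FitznerVanDerHofstad2016NoBLE, Def. 2.9 (condition on γ₂)] -/
theorem f2Bound_o_brackets :
    ¬ ((BetaMap.nobleBetaOfInputs 11 inputsO).f2Bound 11 ≤ 1.10824) ∧ (BetaMap.nobleBetaOfInputs 11 inputsO).f2Bound 11 ≤ 1.108241 := by
  constructor <;> norm_num [NobleBeta.f2Bound, inputsO, max_def, BetaMap.nobleBetaOfInputsCorr, BetaMap.betaRfDeltaCorr, BetaMap.nobleBetaOfInputs, BetaMap.betaMubarOverMu, BetaMap.betaCPhiUp, BetaMap.betaAfLow, BetaMap.betaapI, BetaMap.betaapII, BetaMap.betaPiHat, BetaMap.betaPsiHatLower, BetaMap.betaRp, BetaMap.betaRfDeltaLower]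

set_option maxHeartbeats 4000000 in
/-- `f2Bound(β^corr(inputsO)) ∈ (1.10841, 1.108412]` (D65 float: 1.1084115). [cite: FitznerVanDerHofstad2016NoBLE, Def. 2.9 (condition on γ₂); App. D (D.32)] -/
theorem f2BoundCorr_o_brackets :
    ¬ ((BetaMap.nobleBetaOfInputsCorr 11 inputsO).f2Bound 11 ≤ 1.10841) ∧
      (BetaMap.nobleBetaOfInputsCorr 11 inputsO).f2Bound 11 ≤ 1.108412 := by
  constructor <;> norm_num [NobleBeta.f2Bound, inputsO, max_def, BetaMap.nobleBetaOfInputsCorr, BetaMap.betaRfDeltaCorr, BetaMap.nobleBetaOfInputs, BetaMap.betaMubarOverMu, BetaMap.betaCPhiUp, BetaMap.betaAfLow, BetaMap.betaapI, BetaMap.betaapII, BetaMap.betaPiHat, BetaMap.betaPsiHatLower, BetaMap.betaRp, BetaMap.betaRfDeltaLower]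

set_option maxHeartbeats 4000000 in
/-- **The record's `γ₂` does not absorb the bookkeeping constant on the App.-D line**: `¬ (f2Bound(β^corr(inputsO)) ≤ gammaC 1)`
(`gammaC 1 = 1.108259 < 1.10841`).  A statement about the free parameter `γ₂` on this line, not about the certificate of record.
[cite: FitznerVanDerHofstad2016NoBLE, Def. 2.9 (condition on γ₂)] -/
theorem f2BoundCorr_o_not_le_gammaC : ¬ ((BetaMap.nobleBetaOfInputsCorr 11 inputsO).f2Bound 11 ≤ gammaC 1) := by
  norm_num [NobleBeta.f2Bound, inputsO, gammaC, max_def, BetaMap.nobleBetaOfInputsCorr, BetaMap.betaRfDeltaCorr, BetaMap.nobleBetaOfInputs, BetaMap.betaMubarOverMu, BetaMap.betaCPhiUp, BetaMap.betaAfLow, BetaMap.betaapI, BetaMap.betaapII, BetaMap.betaPiHat, BetaMap.betaPsiHatLower, BetaMap.betaRp, BetaMap.betaRfDeltaLower]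

set_option maxHeartbeats 4000000 in
/-- `f2Bound(β^corr(inputsI)) ≤ 1.064` (initial point: margin `> 4·10⁻²` below either `γ₂`). [cite: FitznerVanDerHofstad2016NoBLE, Def. 2.9; Prop. 2.11 (f₂(z_I) ≤ γ₂)] -/
theorem f2BoundCorr_i_le : (BetaMap.nobleBetaOfInputsCorr 11 inputsI).f2Bound 11 ≤ 1.064 := by
  norm_num [NobleBeta.f2Bound, inputsI, max_def, BetaMap.nobleBetaOfInputsCorr, BetaMap.betaRfDeltaCorr, BetaMap.nobleBetaOfInputs, BetaMap.betaMubarOverMu, BetaMap.betaCPhiUp, BetaMap.betaAfLow, BetaMap.betaapI, BetaMap.betaapII, BetaMap.betaPiHat, BetaMap.betaPsiHatLower, BetaMap.betaRp, BetaMap.betaRfDeltaLower]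

/-! ## 3. The input-level certificate at the `β^corr` tables with `γ'` -/

/-- `f1Bound` does not read the `βΔ` slot. [folklore] -/
theorem f1Bound_corr_eq (i : BetaMap.Inputs) (cμ : ℝ) :
    (BetaMap.nobleBetaOfInputsCorr 11 i).f1Bound 11 cμ = (BetaMap.nobleBetaOfInputs 11 i).f1Bound 11 cμ := rfl

set_option maxHeartbeats 4000000 in
/-- **`P(γ', Γ)` at `d = 11` for the tables `β^corr(inputsI)`, `β^corr(inputsO)`** (`γ' = gammaD65`; `Γ`, `c_μ`, `c`, `bi`, `bo` of
record): the two admissibilities and the two `f₂`-conditions re-evaluated by `norm_num` at the bookkeeping constant, `γ'₂ < Γ₂`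
(`1.10845 < 1.1084502`), the `f₁`-fields transported along `f1Bound_corr_eq`, the `f₃`-fields and `c_μ`, `c` those of
`nobleCertificate_d11_inputs` — `bo` = rev 6's β_Δ-WIRED f₃ table (f₃-TABLE CLAUSE / C46-F3 in the module docstring: the kernel shape of
the D65 certificate, not its corrected numerics).  NOT the certificate of record. [cite: FitznerVanDerHofstad2016NoBLE, Def. 2.9, Prop. 2.11, Assumption 2.7] [cite: FitznerVanDerHofstad2017, §2.5–§2.7 (d = 11)] -/
theorem nobleCertificate_d11_corr :
    NobleNumericCertificate 11 cMuC cWeightsC gammaD65 GammaC (BetaMap.nobleBetaOfInputsCorr 11 inputsI)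
      (BetaMap.nobleBetaOfInputsCorr 11 inputsO) bi bo where
  one_lt_cμ := nobleCertificate_d11_inputs.one_lt_cμ
  c_pos := nobleCertificate_d11_inputs.c_pos
  γ_lt_Γ := by intro i; fin_cases i <;> simp [gammaD65, GammaC] <;> norm_num
  admissible_init := by norm_num [NobleBeta.Admissible, inputsI, BetaMap.nobleBetaOfInputsCorr, BetaMap.betaRfDeltaCorr, BetaMap.nobleBetaOfInputs, BetaMap.betaMubarOverMu, BetaMap.betaCPhiUp, BetaMap.betaAfLow, BetaMap.betaapI, BetaMap.betaapII, BetaMap.betaPiHat, BetaMap.betaPsiHatLower, BetaMap.betaRp, BetaMap.betaRfDeltaLower]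
  admissible := by norm_num [NobleBeta.Admissible, inputsO, BetaMap.nobleBetaOfInputsCorr, BetaMap.betaRfDeltaCorr, BetaMap.nobleBetaOfInputs, BetaMap.betaMubarOverMu, BetaMap.betaCPhiUp, BetaMap.betaAfLow, BetaMap.betaapI, BetaMap.betaapII, BetaMap.betaPiHat, BetaMap.betaPsiHatLower, BetaMap.betaRp, BetaMap.betaRfDeltaLower]
  f1Bound_init_le := by rw [f1Bound_corr_eq, gammaD65_zero]; exact nobleCertificate_d11_inputs.f1Bound_init_le
  f2Bound_init_le := by rw [gammaD65_one]; norm_num [NobleBeta.f2Bound, inputsI, max_def, BetaMap.nobleBetaOfInputsCorr, BetaMap.betaRfDeltaCorr, BetaMap.nobleBetaOfInputs, BetaMap.betaMubarOverMu, BetaMap.betaCPhiUp, BetaMap.betaAfLow, BetaMap.betaapI, BetaMap.betaapII, BetaMap.betaPiHat, BetaMap.betaPsiHatLower, BetaMap.betaRp, BetaMap.betaRfDeltaLower]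
  f3_init_le := by intro k; rw [gammaD65_two]; exact nobleCertificate_d11_inputs.f3_init_le k
  f1Bound_le := by rw [f1Bound_corr_eq, gammaD65_zero]; exact nobleCertificate_d11_inputs.f1Bound_le
  f2Bound_le := by rw [gammaD65_one]; norm_num [NobleBeta.f2Bound, inputsO, max_def, BetaMap.nobleBetaOfInputsCorr, BetaMap.betaRfDeltaCorr, BetaMap.nobleBetaOfInputs, BetaMap.betaMubarOverMu, BetaMap.betaCPhiUp, BetaMap.betaAfLow, BetaMap.betaapI, BetaMap.betaapII, BetaMap.betaPiHat, BetaMap.betaPsiHatLower, BetaMap.betaRp, BetaMap.betaRfDeltaLower]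
  f3_le := by intro k; rw [gammaD65_two]; exact nobleCertificate_d11_inputs.f3_le k

/-! ## 4. The `d = 11` sentence at the `β^corr` tables (oracle binders = module 3c-B's output) -/

/-- **Mean-field behaviour at `d = 11` from the certificate at the `β^corr` tables**: the two oracle binders of [NoBLE17] Prop. 2.11 at
`β^corr(inputsI)` (initial point, with `bi`) and `β^corr(inputsO)` (improvement on the window under `f ≤ Γ`, with `bo`) give the
triangle condition, `θ(p_c) = 0` and `β = 1` on `ℤ^11` — via `meanField_of_certificate` and `nobleCertificate_d11_corr`.  The binders
are what Prop. 4.5(ii) WITH (D.32) DISCHARGED at the bookkeeping constant (module 3c-B, announced) supplies from (S2a) Assumption 4.3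
and (S2b) [FvdH17] Prop. 2.2; until then they are displayed hypotheses.
[cite: FitznerVanDerHofstad2017, Thm 1.1 / Cor. 1.3 (d = 11)] [cite: FitznerVanDerHofstad2016NoBLE, Thm 2.10, Prop. 2.11, Def. 2.9] -/
theorem meanField_d11_corr
    (hI : NobleInitialInputsAt 11 (BetaMap.nobleBetaOfInputsCorr 11 inputsI) bi)
    (hO : NobleImprovementInputsAt 11 cMuC cWeightsC GammaC (BetaMap.nobleBetaOfInputsCorr 11 inputsO) bo) :
    TriangleCondition 11 ∧ PercolationContinuity 11 ∧ BetaEqOneBoundedRatio 11 :=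
  meanField_of_certificate (by norm_num) nobleCertificate_d11_corr hI hO

/-- **[FvdH17] Cor. 1.3 at `d = 11` in full (`MeanField 11`) from the certificate at the `β^corr` tables** (hypotheses as in
`meanField_d11_corr`; the `hO` binder carries rev 6's β_Δ-wired `bo` — f₃-TABLE CLAUSE / C46-F3 in the module docstring). [cite: FitznerVanDerHofstad2017, Cor. 1.3 (d = 11), EJP p. 6] -/
theorem meanField_full_d11_corr
    (hI : NobleInitialInputsAt 11 (BetaMap.nobleBetaOfInputsCorr 11 inputsI) bi)
    (hO : NobleImprovementInputsAt 11 cMuC cWeightsC GammaC (BetaMap.nobleBetaOfInputsCorr 11 inputsO) bo) :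
    MeanField 11 :=
  meanField_of_triangle (by norm_num) (meanField_d11_corr hI hO).1

end D11

end Literature.Probability.FitznerVanDerHofstad2017
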